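import Literature.Geometry.Kaehler.ComplexTorusQuaternionAlgebraCentralizerLefschetzLieAlgebraDimension
import Literature.Geometry.Kaehler.ComplexTorusQuaternionMultiplicationLefschetzGroupConnected
import Literature.Geometry.Kaehler.ComplexTorusRosatiAlbert
import Literature.Geometry.Kaehler.ComplexTorusSimpleEndomorphismCenter
import Literature.RingTheory.CentralSimple.AlbertTypesSymmetricElements
import Literature.NumberTheory.Automorphic.QuaternionAlgebraStructure
import HarnessLib

/-!
# Milne's table, TYPES II and III, read off the ALBERT TYPE: for a simple polarised complex torus of Albert type II
# `2e · dim_ℚ Lie S(X) = g² + eg` («`g²/2f + g/2`», `S = Res Sp`), of Albert type III `2e · dim_ℚ Lie S(X) + eg = g²`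
# («`g²/2f − g/2`», `S = Res O`), `e = [K:ℚ]` the degree of the centre `K = Z(End_ℚ(X))`

Layer `Literature/Geometry/Kaehler`, namespace `Literature.Geometry.Kaehler.ComplexTorus`; lane `lit-hodgefound` (Track 2
foundations library); prover seat `lit-hodgefound-p17`, generation 59, self-proposed row g59-#5 — the FRONT-END of ✔ g59-#4
(`ComplexTorusQuaternionAlgebraCentralizerLefschetzLieAlgebraDimension`: the engine with the quaternionic basis as data).
THEOREMS ONLY (no definition, no instance, no notation, no named fact; D-0026 net debt `0`).

## The argument (Lange Thm. 2.6.5 (b)(c) + Milne §2)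

For `X` simple with Riemann form `η` (rational Gram matrix `G`), `D = End_ℚ(X)` is a skew field with centre the number field
`K` (`centerField`), and the Rosati involution `′` (`rosatiEnd`) is a POSITIVE anti-involution (tree: `isPositiveAntiInvolution_rosatiEnd`).
If `(D, ′)` is of Albert type II resp. III (`IsAlbertTypeII ∕ III K D ′` of `RingTheory/CentralSimple/AlbertTypes`), then by Step II
of Lange's proof (tree: `IsAlbertTypeII ∕ III.forall_eq_standardInvolution_or_exists_units`) `x′ = x̄` or `x′ = a⁻¹ x̄ a` with
`ā = −a`; positivity excludes `x̄` for type II (Step III, tree: `isTotallyDefinite_of_isPositiveAntiInvolution`) and `a⁻¹ x̄ a` for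
type III (Step IV, tree: `isTotallyIndefinite_of_isPositiveAntiInvolution_conj`).  A quaternionic basis `D = K ⊕ Ki ⊕ Kj ⊕ Kij`
(`i² = α`, `j² = β`, `ij = −ji`; tree: `IsQuaternionAlgebra.exists_algEquiv_quaternionAlgebra`, and THROUGH `a` — `i = a` —
`exists_algEquiv_quaternionAlgebra_apply_eq`) then has `i′ = −i` and `j′ = −j` (type III: pure quaternions are `x̄`-skew) resp.
`j′ = a⁻¹(−j)a = j` (type II), and ✔ g59-#4 gives the dimension of `Lie S(X) = {A ∣ [A, D] = 0, ᵗA G = −G A}`.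

## Sources, VERBATIM

* J. S. Milne [Milne1999LefschetzClasses], Duke Math. J. **96** (1999) (held `paper:doi-10-1215-s0012-7094-99-09620-5`), §2 p. 649–651
  (types II, III: «`S(A)_{/k^al} = ∏_σ U(φ_{1,σ}) ∩ Sp(φ_{2,σ})` … identifies … with `Sp(φ_{2,σ₁})`», «type III. This is similar …»),
  Summary table p. 652 (p0014 L5–L20): «II ∣ `Sp` ∣ … `g²/2f + g/2`», «III ∣ `O` ∣ … `g²/2f − g/2`» («`f = [F:ℚ]`, `F` the centre»).
* H. Lange [Lange2023AbelianVarietiesComplex], *Abelian Varieties over the Complex Numbers* (2023), §2.6.2 Thm. 2.6.5 (b), (c) and its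
  proof, Steps II–IV (PDF p0141 L28 – p0143 L16); §2.6.1 Proposition (table lines II, III).
* D. Mumford [MumfordAV1970], *Abelian Varieties*, §21 Thm. 2 and the table following it (types II, III).

## What is proved (all for `X` simple, `η` a Riemann form with rational Gram matrix `G`, `K = centerField`, `e = [K:ℚ]`, `g = dim X`)

* **`IsSimple.two_mul_finrank_mul_finrank_lefschetzLieRat_eq_of_isAlbertTypeII`**: `2e · dim_ℚ Lie S(X) = g² + eg`;
  **`IsSimple.two_mul_finrank_mul_finrank_lefschetzLieRat_add_eq_of_isAlbertTypeIII`**: `2e · dim_ℚ Lie S(X) + eg = g²`;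
  the `𝔩𝔣 = Lie Lf(X)(ℝ)` forms; the Hodge bounds `IsSimple.two_mul_finrank_mul_finrank_hodgeGroupLie_le_of_isAlbertTypeII ∕ III`;
  `Hg(X)(ℂ) = Lf(X)(ℂ)` iff equality (`IsSimple.hodgeGroupC_eq_lefschetzIdentityC_iff_…`); and, for type II where `S(X)` is connected
  (tree: `IsSimple.lefschetzIdentityC_eq_lefschetzGroupC_of_isAlbertTypeII`), criterion (D) on all powers ⟺ `2e · dim_ℝ 𝔥𝔤_ℝ = g² + eg`
  (`IsSimple.forall_divisorClasses_powPeriod_eq_hodgeClasses_iff_…_of_isAlbertTypeII`).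
-/

noncomputable section

open scoped Matrix Quaternion
open Module Matrix Complex Function NumberField
open Literature.RingTheory.CentralSimple (IsAlbertTypeII IsAlbertTypeIII IsOfFirstKind isTotallyDefinite_of_isPositiveAntiInvolution
  isTotallyIndefinite_of_isPositiveAntiInvolution_conj exists_algEquiv_quaternionAlgebra_apply_eq)
open Literature.NumberTheory.Automorphic (standardInvolution IsQuaternionAlgebra standardInvolution_algEquiv
  standardInvolution_quaternionAlgebra standardInvolution_algebraMap)

namespace Literature.Geometry.Kaehler

namespace ComplexTorus

/-! ## §0 A quaternionic frame read through a model `D ≃ₐ[K] ℍ[K,α,β]` -/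

section Frame

variable {K D : Type} [Field K] [CharZero K] [Ring D] [Algebra K D]

/-- **The frame `i = e⁻¹(i)`, `j = e⁻¹(j)` of a model `e : D ≃ ℍ[K,α,β]`**: `i² = α`, `j² = β`, `ij = −ji`, `ī = −i`, `j̄ = −j`, and
`x = x₀ + x₁ i + x₂ j + x₃ ij` with the coordinates of `e x`. [cite: Lange2023AbelianVarietiesComplex, §2.6.2 proof of Thm. 2.6.5, Step II («`F = K + Ka + Kb + Kab`»)] -/
private theorem frame {α β : K} (e : D ≃ₐ[K] ℍ[K,α,β]) :
    e.symm ⟨0, 1, 0, 0⟩ * e.symm ⟨0, 1, 0, 0⟩ = algebraMap K D α ∧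
    e.symm ⟨0, 0, 1, 0⟩ * e.symm ⟨0, 0, 1, 0⟩ = algebraMap K D β ∧
    e.symm ⟨0, 1, 0, 0⟩ * e.symm ⟨0, 0, 1, 0⟩ = -(e.symm ⟨0, 0, 1, 0⟩ * e.symm ⟨0, 1, 0, 0⟩) ∧
    standardInvolution K D (e.symm ⟨0, 1, 0, 0⟩) = -e.symm ⟨0, 1, 0, 0⟩ ∧
    standardInvolution K D (e.symm ⟨0, 0, 1, 0⟩) = -e.symm ⟨0, 0, 1, 0⟩ ∧
    ∀ x : D, x = algebraMap K D (e x).re + algebraMap K D (e x).imI * e.symm ⟨0, 1, 0, 0⟩ +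
      algebraMap K D (e x).imJ * e.symm ⟨0, 0, 1, 0⟩ + algebraMap K D (e x).imK * (e.symm ⟨0, 1, 0, 0⟩ * e.symm ⟨0, 0, 1, 0⟩) := by
  refine ⟨e.injective ?_, e.injective ?_, e.injective ?_, e.injective ?_, e.injective ?_, fun x ↦ e.injective ?_⟩
  · rw [map_mul, AlgEquiv.apply_symm_apply, AlgEquiv.commutes]; ext <;> simp
  · rw [map_mul, AlgEquiv.apply_symm_apply, AlgEquiv.commutes]; ext <;> simp
  · rw [map_mul, map_neg, map_mul, AlgEquiv.apply_symm_apply, AlgEquiv.apply_symm_apply]; ext <;> simp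
  · rw [← standardInvolution_algEquiv e, AlgEquiv.apply_symm_apply, standardInvolution_quaternionAlgebra, map_neg,
      AlgEquiv.apply_symm_apply]; ext <;> simp
  · rw [← standardInvolution_algEquiv e, AlgEquiv.apply_symm_apply, standardInvolution_quaternionAlgebra, map_neg,
      AlgEquiv.apply_symm_apply]; ext <;> simp
  · rw [map_add, map_add, map_add, map_mul, map_mul, map_mul, map_mul, AlgEquiv.commutes, AlgEquiv.commutes, AlgEquiv.commutes,
      AlgEquiv.commutes, AlgEquiv.apply_symm_apply, AlgEquiv.apply_symm_apply]
    ext <;> simp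

/-- `a⁻¹ (−a) a = −a` for a unit `a`. [folklore] -/
private theorem units_inv_mul_neg_self_mul (a : Dˣ) : (↑a⁻¹ : D) * -(a : D) * a = -(a : D) := by
  rw [mul_neg, Units.inv_mul, neg_mul, one_mul]

/-- `a⁻¹ (−j) a = j` for a unit `a` anticommuting with `j`. [folklore] -/
private theorem units_inv_mul_neg_mul_eq_of_mul_eq_neg (a : Dˣ) {j : D} (hja : j * a = -((a : D) * j)) :
    (↑a⁻¹ : D) * -j * a = j := by
  rw [mul_neg, neg_mul, mul_assoc, hja, mul_neg, Units.inv_mul_cancel_left, neg_neg]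

end Frame

section Albert

variable {κ : Type} [Fintype κ] [DecidableEq κ] [Nonempty κ] {E : Type} [NormedAddCommGroup E] [NormedSpace ℂ E]
  {Ψ : (κ → ℝ) ≃L[ℝ] E} {η : E [⋀^Fin 2]→L[ℝ] ℝ} {G : Matrix κ κ ℚ}

/-- **FROM A ROSATI-SKEW QUATERNIONIC FRAME OF `End_ℚ(X)` OVER ITS CENTRE TO THE MATRIX DATA OF THE ENGINE** (✔ g59-#4): for `X`
simple, `′` of the first kind on `K = Z(End_ℚ(X))`, and a model `e : End_ℚ(X) ≃ ℍ[K,α,β]` with `i′ = −i`: the inclusion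
`f : K → M_{2g}(ℚ)` is Rosati-fixed, `I = i`, `J = j` satisfy `I² = f(α)`, `J² = f(β)`, `IJ = −JI`, commute with `f(K)`,
`End_ℚ(X) = f(K) ⊕ f(K)I ⊕ f(K)J ⊕ f(K)IJ`, and `I† = −I`. [cite: Lange2023AbelianVarietiesComplex, §2.6.2 Thm. 2.6.5 (b)(c), proof Step II]
[cite: Milne1999LefschetzClasses, §2 p. 649–651] -/
private theorem albert_frame (hX : IsSimple Ψ) (hη : IsRiemannForm Ψ η) (hG : G.map (Rat.cast : ℚ → ℝ) = latticeGram Ψ η)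
    {α β : centerField Ψ hX} (hα : α ≠ 0) (hβ : β ≠ 0) (e : endAlgRat Ψ ≃ₐ[centerField Ψ hX] ℍ[centerField Ψ hX,α,β])
    (h1 : IsOfFirstKind (centerField Ψ hX) (endAlgRat Ψ) (rosatiEnd Ψ hη.1 hη.2.2 hG))
    (hi : rosatiEnd Ψ hη.1 hη.2.2 hG (e.symm ⟨0, 1, 0, 0⟩) = -e.symm ⟨0, 1, 0, 0⟩) :
    ∃ (f : centerField Ψ hX →ₐ[ℚ] Matrix κ κ ℚ) (I J : Matrix κ κ ℚ) (a b : centerField Ψ hX),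
      (∀ x, rosati G (f x) = f x) ∧ a ≠ 0 ∧ b ≠ 0 ∧ I * I = f a ∧ J * J = f b ∧ I * J = -(J * I) ∧ (∀ x, I * f x = f x * I) ∧
      (∀ x, J * f x = f x * J) ∧
      (∀ B, B ∈ endAlgRat Ψ ↔ ∃ c : Fin 4 → centerField Ψ hX, B = f (c 0) + f (c 1) * I + f (c 2) * J + f (c 3) * (I * J)) ∧
      rosati G I = -I ∧ J = ((e.symm ⟨0, 0, 1, 0⟩ : endAlgRat Ψ) : Matrix κ κ ℚ) ∧ finrank ℚ (centerField Ψ hX) = finrank ℚ (centerField Ψ hX) := by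
  obtain ⟨hii, hjj, hij, -, -, hdec⟩ := frame e
  set iD : endAlgRat Ψ := e.symm ⟨0, 1, 0, 0⟩ with hiD
  set jD : endAlgRat Ψ := e.symm ⟨0, 0, 1, 0⟩ with hjD
  refine ⟨centerField.valAlgHom Ψ hX, (iD : Matrix κ κ ℚ), (jD : Matrix κ κ ℚ), α, β, fun x ↦ ?_, hα, hβ, ?_, ?_, ?_, fun x ↦ ?_,
    fun x ↦ ?_, fun B ↦ ?_, ?_, rfl, rfl⟩
  · -- first kind: `val x` is Rosati-fixed
    have h := congrArg Subtype.val (h1 x)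
    rw [coe_rosatiEnd, centerField.coe_algebraMap] at h
    rw [centerField.valAlgHom_apply, h]
  · have h := congrArg Subtype.val hii
    rw [Subalgebra.coe_mul, centerField.coe_algebraMap] at h
    rw [centerField.valAlgHom_apply, h]
  · have h := congrArg Subtype.val hjj
    rw [Subalgebra.coe_mul, centerField.coe_algebraMap] at h
    rw [centerField.valAlgHom_apply, h]
  · have h := congrArg Subtype.val hij
    rw [Subalgebra.coe_mul, NegMemClass.coe_neg, Subalgebra.coe_mul] at h
    exact h
  · rw [centerField.valAlgHom_apply]; exact (centerField.val_comm Ψ hX x iD.2).symm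
  · rw [centerField.valAlgHom_apply]; exact (centerField.val_comm Ψ hX x jD.2).symm
  · constructor
    · intro hB
      have h := congrArg Subtype.val (hdec ⟨B, hB⟩)
      simp only [Subalgebra.coe_add, Subalgebra.coe_mul, centerField.coe_algebraMap] at h
      refine ⟨![(e ⟨B, hB⟩).re, (e ⟨B, hB⟩).imI, (e ⟨B, hB⟩).imJ, (e ⟨B, hB⟩).imK], ?_⟩
      simp only [centerField.valAlgHom_apply, Matrix.cons_val_zero, Matrix.cons_val_one, Matrix.cons_val]
      exact h
    · rintro ⟨c, rfl⟩
      simp only [centerField.valAlgHom_apply]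
      refine Subalgebra.add_mem _ (Subalgebra.add_mem _ (Subalgebra.add_mem _ (centerField.val_mem Ψ hX _) (Subalgebra.mul_mem _
        (centerField.val_mem Ψ hX _) iD.2)) (Subalgebra.mul_mem _ (centerField.val_mem Ψ hX _) jD.2)) (Subalgebra.mul_mem _
        (centerField.val_mem Ψ hX _) (Subalgebra.mul_mem _ iD.2 jD.2))
  · have h := congrArg Subtype.val hi
    rw [coe_rosatiEnd, NegMemClass.coe_neg] at h
    exact h

/-- `ℚ ⊆ K ⊆ End_ℚ(X)` is a scalar tower. [folklore] -/
private theorem isScalarTower_rat (hX : IsSimple Ψ) : IsScalarTower ℚ (centerField Ψ hX) (endAlgRat Ψ) :=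
  IsScalarTower.of_algebraMap_smul fun q x ↦ by
    rw [Algebra.smul_def, Algebra.algebraMap_eq_smul_one q, map_rat_smul (algebraMap (centerField Ψ hX) (endAlgRat Ψ)) q 1, map_one,
      smul_mul_assoc, one_mul]

/-- **TYPE II: the Rosati-skew frame exists** — for `(End_ℚ(X), ′)` of Albert type II, `x′ = a⁻¹ x̄ a` with `ā = −a` (Lange (b); `x̄`
is excluded by positivity, Step III), and a quaternionic basis through `i = a` has `i′ = −i`, `j′ = j`.
[cite: Lange2023AbelianVarietiesComplex, §2.6.2 Thm. 2.6.5 (b) and proof, Steps II–III (PDF p0141 L30 – p0143 L16)] -/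
private theorem exists_frame_of_isAlbertTypeII (hX : IsSimple Ψ) (hη : IsRiemannForm Ψ η) (hG : G.map (Rat.cast : ℚ → ℝ) = latticeGram Ψ η)
    (h : IsAlbertTypeII (centerField Ψ hX) (endAlgRat Ψ) (rosatiEnd Ψ hη.1 hη.2.2 hG)) :
    ∃ (α β : centerField Ψ hX) (e : endAlgRat Ψ ≃ₐ[centerField Ψ hX] ℍ[centerField Ψ hX,α,β]), α ≠ 0 ∧ β ≠ 0 ∧
      rosatiEnd Ψ hη.1 hη.2.2 hG (e.symm ⟨0, 1, 0, 0⟩) = -e.symm ⟨0, 1, 0, 0⟩ ∧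
      rosatiEnd Ψ hη.1 hη.2.2 hG (e.symm ⟨0, 0, 1, 0⟩) = e.symm ⟨0, 0, 1, 0⟩ := by
  set K := centerField Ψ hX
  set ι := rosatiEnd Ψ hη.1 hη.2.2 hG
  haveI := h.isQuaternionAlgebra
  haveI := h.isTotallyReal
  haveI : IsScalarTower ℚ K (endAlgRat Ψ) := isScalarTower_rat hX
  have hD : ∀ x : endAlgRat Ψ, x ≠ 0 → IsUnit x := fun x hx ↦ hX.isUnit_endAlgRat hx
  have hpos := isPositiveAntiInvolution_rosatiEnd Ψ hη.1 hη.2.2 hG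
  rcases h.forall_eq_standardInvolution_or_exists_units K hpos.toIsAntiInvolution with hc | ⟨a, ha, hιa, haa⟩
  · exfalso
    have hdef := isTotallyDefinite_of_isPositiveAntiInvolution K hc hpos
    obtain ⟨w⟩ := (inferInstance : Nonempty (InfinitePlace K))
    exact hdef w (h.isTotallyIndefinite.isSplitAtInfinite w)
  · have h4 := IsQuaternionAlgebra.finrank_eq_four (K := K) (D := endAlgRat Ψ)
    haveI : Nontrivial (endAlgRat Ψ) := Module.nontrivial_of_finrank_pos (R := K) (by omega)
    have hbot : (a : endAlgRat Ψ) ∉ (⊥ : Subalgebra K (endAlgRat Ψ)) := by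
      intro hmem
      obtain ⟨c, hc⟩ := Algebra.mem_bot.1 hmem
      have hfix := standardInvolution_algebraMap K (D := endAlgRat Ψ) c
      rw [hc, ha] at hfix
      have h2 : (2 : K) • (a : endAlgRat Ψ) = 0 := by rw [two_smul]; nth_rw 1 [← hfix]; exact neg_add_cancel _
      exact a.ne_zero ((smul_eq_zero.1 h2).resolve_left two_ne_zero)
    obtain ⟨β, hα, hβ, e, hea⟩ := exists_algEquiv_quaternionAlgebra_apply_eq K hD hbot haa
    have hia : e.symm ⟨0, 1, 0, 0⟩ = a := by rw [← hea, e.symm_apply_apply]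
    obtain ⟨-, -, hij, -, hjstd, -⟩ := frame e
    rw [hia] at hij
    refine ⟨_, β, e, hα, hβ, ?_, ?_⟩
    · rw [hia, hιa, ha]
      exact units_inv_mul_neg_self_mul a
    · have hja : e.symm ⟨0, 0, 1, 0⟩ * (a : endAlgRat Ψ) = -((a : endAlgRat Ψ) * e.symm ⟨0, 0, 1, 0⟩) := by rw [hij, neg_neg]
      rw [hιa, hjstd]
      exact units_inv_mul_neg_mul_eq_of_mul_eq_neg a hja

/-- **TYPE III: the Rosati-skew frame exists** — for `(End_ℚ(X), ′)` of Albert type III, `x′ = x̄` (Lange (c); `a⁻¹ x̄ a` is excluded by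
positivity, Step IV), and any quaternionic basis has `i′ = −i`, `j′ = −j`.
[cite: Lange2023AbelianVarietiesComplex, §2.6.2 Thm. 2.6.5 (c) and proof, Steps II, IV (PDF p0142 L1–L4, p0143)] -/
private theorem exists_frame_of_isAlbertTypeIII (hX : IsSimple Ψ) (hη : IsRiemannForm Ψ η) (hG : G.map (Rat.cast : ℚ → ℝ) = latticeGram Ψ η)
    (h : IsAlbertTypeIII (centerField Ψ hX) (endAlgRat Ψ) (rosatiEnd Ψ hη.1 hη.2.2 hG)) :
    ∃ (α β : centerField Ψ hX) (e : endAlgRat Ψ ≃ₐ[centerField Ψ hX] ℍ[centerField Ψ hX,α,β]), α ≠ 0 ∧ β ≠ 0 ∧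
      rosatiEnd Ψ hη.1 hη.2.2 hG (e.symm ⟨0, 1, 0, 0⟩) = -e.symm ⟨0, 1, 0, 0⟩ ∧
      rosatiEnd Ψ hη.1 hη.2.2 hG (e.symm ⟨0, 0, 1, 0⟩) = -e.symm ⟨0, 0, 1, 0⟩ := by
  set K := centerField Ψ hX
  set ι := rosatiEnd Ψ hη.1 hη.2.2 hG
  haveI := h.isQuaternionAlgebra
  haveI := h.isTotallyReal
  haveI : IsScalarTower ℚ K (endAlgRat Ψ) := isScalarTower_rat hX
  have hD : ∀ x : endAlgRat Ψ, x ≠ 0 → IsUnit x := fun x hx ↦ hX.isUnit_endAlgRat hx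
  have hpos := isPositiveAntiInvolution_rosatiEnd Ψ hη.1 hη.2.2 hG
  rcases h.forall_eq_standardInvolution_or_exists_units K hpos.toIsAntiInvolution with hc | ⟨a, ha, hιa, -⟩
  · obtain ⟨α, β, hα, hβ, ⟨e⟩⟩ := IsQuaternionAlgebra.exists_algEquiv_quaternionAlgebra K (endAlgRat Ψ)
    obtain ⟨-, -, -, histd, hjstd, -⟩ := frame e
    exact ⟨α, β, e, hα, hβ, by rw [hc, histd], by rw [hc, hjstd]⟩
  · exfalso
    have hind := isTotallyIndefinite_of_isPositiveAntiInvolution_conj K hD a ha hιa hpos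
    obtain ⟨w⟩ := (inferInstance : Nonempty (InfinitePlace K))
    exact h.isTotallyDefinite w (hind.isSplitAtInfinite w)

/-! ## §1 Type II: `2e · dim_ℚ Lie S(X) = g² + eg` -/

variable [FiniteDimensional ℂ E]

/-- **MILNE'S TABLE, TYPE II, READ OFF THE ALBERT TYPE: `2[K:ℚ] · dim_ℚ Lie S(X) = g² + g[K:ℚ]`** («II ∣ `Sp` ∣ … `g²/2f + g/2`»; `K`
the centre of `End_ℚ(X)`, `S(X)_{/k^al} ≅ ∏_{σ:K→k^al} Sp_{g/[K:ℚ]}`) for a SIMPLE polarised complex torus of Albert type II.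
[cite: Milne1999LefschetzClasses, §2 p. 649–650 (type II) and Summary table p. 652] [cite: Lange2023AbelianVarietiesComplex, §2.6.2 Thm. 2.6.5 (b)] -/
theorem IsSimple.two_mul_finrank_mul_finrank_lefschetzLieRat_eq_of_isAlbertTypeII (hX : IsSimple Ψ) (hη : IsRiemannForm Ψ η)
    (hG : G.map (Rat.cast : ℚ → ℝ) = latticeGram Ψ η) (h : IsAlbertTypeII (centerField Ψ hX) (endAlgRat Ψ) (rosatiEnd Ψ hη.1 hη.2.2 hG)) :
    2 * (finrank ℚ (centerField Ψ hX) * finrank ℚ (lefschetzLieRat Ψ G)) =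
      finrank ℂ E ^ 2 + finrank ℚ (centerField Ψ hX) * finrank ℂ E := by
  obtain ⟨α, β, e, hα, hβ, hi, hj⟩ := exists_frame_of_isAlbertTypeII hX hη hG h
  obtain ⟨f, I, J, a, b, hfix, ha, hb, hI, hJ, hIJ, hIf, hJf, hE, hIros, hJe, -⟩ := albert_frame hX hη hG hα hβ e h.isOfFirstKind hi
  have hJros : rosati G J = J := by
    have h' := congrArg Subtype.val hj
    rw [coe_rosatiEnd] at h'
    rw [hJe, h']
  exact two_mul_finrank_mul_finrank_lefschetzLieRat_eq_of_quaternion_of_rosati_eq_self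
    (isUnit_det_of_map_ratCast hG hη.isUnit_det_latticeGram) (transpose_eq_neg_of_map_ratCast Ψ hG) f hfix ha hb hI hJ hIJ hIf hJf hE
    hIros hJros

/-- TYPE II in `𝔩𝔣 = Lie Lf(X)(ℝ)`: `2[K:ℚ] · dim_ℝ 𝔩𝔣 = g² + g[K:ℚ]`. [cite: Milne1999LefschetzClasses, §2 Summary table p. 652 (type II) and Remark 1.6] -/
theorem IsSimple.two_mul_finrank_mul_finrank_lefschetzLie_eq_of_isAlbertTypeII (hX : IsSimple Ψ) (hη : IsRiemannForm Ψ η)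
    (hG : G.map (Rat.cast : ℚ → ℝ) = latticeGram Ψ η) (h : IsAlbertTypeII (centerField Ψ hX) (endAlgRat Ψ) (rosatiEnd Ψ hη.1 hη.2.2 hG)) :
    2 * (finrank ℚ (centerField Ψ hX) * finrank ℝ (lefschetzLie Ψ G)) = finrank ℂ E ^ 2 + finrank ℚ (centerField Ψ hX) * finrank ℂ E := by
  rw [← finrank_lefschetzLieRat_eq_finrank_lefschetzLie]
  exact hX.two_mul_finrank_mul_finrank_lefschetzLieRat_eq_of_isAlbertTypeII hη hG h

/-- **THE HODGE BOUND, TYPE II: `2[K:ℚ] · dim_ℝ 𝔥𝔤_ℝ ≤ g² + g[K:ℚ]`** (`Hg(X) ⊆ Lf(X) = S(X)`, connected for type II).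
[cite: Milne1999LefschetzClasses, §4 («`Hg(A) ⊂ L(A)`») and §2 Summary table p. 652 (type II)] -/
theorem IsSimple.two_mul_finrank_mul_finrank_hodgeGroupLie_le_of_isAlbertTypeII (hX : IsSimple Ψ) (hη : IsRiemannForm Ψ η)
    (hG : G.map (Rat.cast : ℚ → ℝ) = latticeGram Ψ η) (h : IsAlbertTypeII (centerField Ψ hX) (endAlgRat Ψ) (rosatiEnd Ψ hη.1 hη.2.2 hG)) :
    2 * (finrank ℚ (centerField Ψ hX) * finrank ℝ (hodgeGroupLie Ψ)) ≤ finrank ℂ E ^ 2 + finrank ℚ (centerField Ψ hX) * finrank ℂ E := by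
  rw [← hX.two_mul_finrank_mul_finrank_lefschetzLie_eq_of_isAlbertTypeII hη hG h]
  exact Nat.mul_le_mul_left 2 (Nat.mul_le_mul_left _ (hη.finrank_hodgeGroupLie_le_finrank_lefschetzLie hG))

/-- **TYPE II: `Hg(X)(ℂ) = Lf(X)(ℂ) = S(X)(ℂ)` ⟺ `2[K:ℚ] · dim_ℝ 𝔥𝔤_ℝ = g² + g[K:ℚ]`.**
[cite: Milne1999LefschetzClasses, §2 (type II) and §4 Prop. 4.8] [cite: Lange2023AbelianVarietiesComplex, §2.6.2 Thm. 2.6.5 (b)] -/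
theorem IsSimple.hodgeGroupC_eq_lefschetzIdentityC_iff_two_mul_finrank_mul_finrank_hodgeGroupLie_eq_of_isAlbertTypeII (hX : IsSimple Ψ)
    (hη : IsRiemannForm Ψ η) (hG : G.map (Rat.cast : ℚ → ℝ) = latticeGram Ψ η)
    (h : IsAlbertTypeII (centerField Ψ hX) (endAlgRat Ψ) (rosatiEnd Ψ hη.1 hη.2.2 hG)) :
    hodgeGroupC Ψ = lefschetzIdentityC Ψ G ↔
      2 * (finrank ℚ (centerField Ψ hX) * finrank ℝ (hodgeGroupLie Ψ)) = finrank ℂ E ^ 2 + finrank ℚ (centerField Ψ hX) * finrank ℂ E := by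
  rw [hη.hodgeGroupC_eq_lefschetzIdentityC_iff_finrank_eq hG, ← hX.two_mul_finrank_mul_finrank_lefschetzLie_eq_of_isAlbertTypeII hη hG h]
  have he : 0 < finrank ℚ (centerField Ψ hX) := finrank_pos
  constructor
  · intro h'; rw [h']
  · intro h'; exact Nat.eq_of_mul_eq_mul_left he (Nat.eq_of_mul_eq_mul_left two_pos h')

/-- **TYPE II, CRITERION (D) ON ALL POWERS: `𝒟•(Xᵏ) = ℬ•(Xᵏ)` for all `k` ⟺ `2[K:ℚ] · dim_ℝ 𝔥𝔤_ℝ = g² + g[K:ℚ]`** (for type II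
`S(X)` is connected — tree `IsSimple.lefschetzIdentityC_eq_lefschetzGroupC_of_isAlbertTypeII` — so Milne's Prop. 4.8 reduces (D) to
`Hg = Lf`, i.e. to the dimension count). [cite: Milne1999LefschetzClasses, §4 Prop. 4.8 and §2 Summary table (type II: «Connected: Yes»)]
[cite: Lange2023AbelianVarietiesComplex, §7.2.4 Exercise (4)] -/
theorem IsSimple.forall_divisorClasses_powPeriod_eq_hodgeClasses_iff_two_mul_finrank_mul_finrank_hodgeGroupLie_eq_of_isAlbertTypeII
    (hX : IsSimple Ψ) (hη : IsRiemannForm Ψ η) (hG : G.map (Rat.cast : ℚ → ℝ) = latticeGram Ψ η)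
    (h : IsAlbertTypeII (centerField Ψ hX) (endAlgRat Ψ) (rosatiEnd Ψ hη.1 hη.2.2 hG)) :
    (∀ k p : ℕ, divisorClasses (powPeriod Ψ k) p = hodgeClasses (powPeriod Ψ k) p) ↔
      2 * (finrank ℚ (centerField Ψ hX) * finrank ℝ (hodgeGroupLie Ψ)) = finrank ℂ E ^ 2 + finrank ℚ (centerField Ψ hX) * finrank ℂ E := by
  have hE : 0 < finrank ℂ E := by
    have := card_eq_two_mul_finrank Ψ
    have : 0 < Fintype.card κ := Fintype.card_pos
    omega
  rw [hη.forall_divisorClasses_powPeriod_eq_hodgeClasses_iff_eq_and_finrank_eq hG hE, ← hη.hodgeGroupC_eq_lefschetzIdentityC_iff_finrank_eq hG,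
    hX.hodgeGroupC_eq_lefschetzIdentityC_iff_two_mul_finrank_mul_finrank_hodgeGroupLie_eq_of_isAlbertTypeII hη hG h]
  exact ⟨fun h' ↦ h'.2, fun h' ↦ ⟨hX.lefschetzIdentityC_eq_lefschetzGroupC_of_isAlbertTypeII hη hG h, h'⟩⟩

/-! ## §2 Type III: `2e · dim_ℚ Lie S(X) + eg = g²` -/

/-- **MILNE'S TABLE, TYPE III, READ OFF THE ALBERT TYPE: `2[K:ℚ] · dim_ℚ Lie S(X) + g[K:ℚ] = g²`** («III ∣ `O` ∣ … `g²/2f − g/2`»;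
`S(X)_{/k^al} ≅ ∏_σ O_{g/[K:ℚ]}`) for a SIMPLE polarised complex torus of Albert type III.
[cite: Milne1999LefschetzClasses, §2 p. 650–651 (type III) and Summary table p. 652] [cite: Lange2023AbelianVarietiesComplex, §2.6.2 Thm. 2.6.5 (c)] -/
theorem IsSimple.two_mul_finrank_mul_finrank_lefschetzLieRat_add_eq_of_isAlbertTypeIII (hX : IsSimple Ψ) (hη : IsRiemannForm Ψ η)
    (hG : G.map (Rat.cast : ℚ → ℝ) = latticeGram Ψ η) (h : IsAlbertTypeIII (centerField Ψ hX) (endAlgRat Ψ) (rosatiEnd Ψ hη.1 hη.2.2 hG)) :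
    2 * (finrank ℚ (centerField Ψ hX) * finrank ℚ (lefschetzLieRat Ψ G)) + finrank ℚ (centerField Ψ hX) * finrank ℂ E = finrank ℂ E ^ 2 := by
  obtain ⟨α, β, e, hα, hβ, hi, hj⟩ := exists_frame_of_isAlbertTypeIII hX hη hG h
  obtain ⟨f, I, J, a, b, hfix, ha, hb, hI, hJ, hIJ, hIf, hJf, hE, hIros, hJe, -⟩ := albert_frame hX hη hG hα hβ e h.isOfFirstKind hi
  have hJros : rosati G J = -J := by
    have h' := congrArg Subtype.val hj
    rw [coe_rosatiEnd, NegMemClass.coe_neg] at h'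
    rw [hJe, h']
  exact two_mul_finrank_mul_finrank_lefschetzLieRat_add_eq_of_quaternion_of_rosati_eq_neg
    (isUnit_det_of_map_ratCast hG hη.isUnit_det_latticeGram) (transpose_eq_neg_of_map_ratCast Ψ hG) f hfix ha hb hI hJ hIJ hIf hJf hE
    hIros hJros

/-- TYPE III in `𝔩𝔣 = Lie Lf(X)(ℝ)`: `2[K:ℚ] · dim_ℝ 𝔩𝔣 + g[K:ℚ] = g²`. [cite: Milne1999LefschetzClasses, §2 Summary table p. 652 (type III) and Remark 1.6] -/
theorem IsSimple.two_mul_finrank_mul_finrank_lefschetzLie_add_eq_of_isAlbertTypeIII (hX : IsSimple Ψ) (hη : IsRiemannForm Ψ η)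
    (hG : G.map (Rat.cast : ℚ → ℝ) = latticeGram Ψ η) (h : IsAlbertTypeIII (centerField Ψ hX) (endAlgRat Ψ) (rosatiEnd Ψ hη.1 hη.2.2 hG)) :
    2 * (finrank ℚ (centerField Ψ hX) * finrank ℝ (lefschetzLie Ψ G)) + finrank ℚ (centerField Ψ hX) * finrank ℂ E = finrank ℂ E ^ 2 := by
  rw [← finrank_lefschetzLieRat_eq_finrank_lefschetzLie]
  exact hX.two_mul_finrank_mul_finrank_lefschetzLieRat_add_eq_of_isAlbertTypeIII hη hG h

/-- **THE HODGE BOUND, TYPE III: `2[K:ℚ] · dim_ℝ 𝔥𝔤_ℝ + g[K:ℚ] ≤ g²`** (`Hg(X) ⊆ Lf(X) = S(X)°`).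
[cite: Milne1999LefschetzClasses, §4 («`Hg(A) ⊂ L(A)`», Remark 4.9) and §2 Summary table p. 652 (type III)] -/
theorem IsSimple.two_mul_finrank_mul_finrank_hodgeGroupLie_le_of_isAlbertTypeIII (hX : IsSimple Ψ) (hη : IsRiemannForm Ψ η)
    (hG : G.map (Rat.cast : ℚ → ℝ) = latticeGram Ψ η) (h : IsAlbertTypeIII (centerField Ψ hX) (endAlgRat Ψ) (rosatiEnd Ψ hη.1 hη.2.2 hG)) :
    2 * (finrank ℚ (centerField Ψ hX) * finrank ℝ (hodgeGroupLie Ψ)) + finrank ℚ (centerField Ψ hX) * finrank ℂ E ≤ finrank ℂ E ^ 2 := by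
  rw [← hX.two_mul_finrank_mul_finrank_lefschetzLie_add_eq_of_isAlbertTypeIII hη hG h]
  exact Nat.add_le_add_right (Nat.mul_le_mul_left 2 (Nat.mul_le_mul_left _ (hη.finrank_hodgeGroupLie_le_finrank_lefschetzLie hG))) _

/-- **TYPE III: `Hg(X)(ℂ) = Lf(X)(ℂ)` (`= S(X)°(ℂ)`) ⟺ `2[K:ℚ] · dim_ℝ 𝔥𝔤_ℝ + g[K:ℚ] = g²`** (for type III `S(X)` is NOT connected and
some power carries an exotic Hodge class regardless — tree `ComplexTorusAlbertTypeIIIStablyDegenerate`; this is the statement about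
the identity component). [cite: Milne1999LefschetzClasses, §2 (type III), §4 Prop. 4.8 and Remark 4.9] [cite: Lange2023AbelianVarietiesComplex, §2.6.2 Thm. 2.6.5 (c)] -/
theorem IsSimple.hodgeGroupC_eq_lefschetzIdentityC_iff_two_mul_finrank_mul_finrank_hodgeGroupLie_add_eq_of_isAlbertTypeIII (hX : IsSimple Ψ)
    (hη : IsRiemannForm Ψ η) (hG : G.map (Rat.cast : ℚ → ℝ) = latticeGram Ψ η)
    (h : IsAlbertTypeIII (centerField Ψ hX) (endAlgRat Ψ) (rosatiEnd Ψ hη.1 hη.2.2 hG)) :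
    hodgeGroupC Ψ = lefschetzIdentityC Ψ G ↔
      2 * (finrank ℚ (centerField Ψ hX) * finrank ℝ (hodgeGroupLie Ψ)) + finrank ℚ (centerField Ψ hX) * finrank ℂ E = finrank ℂ E ^ 2 := by
  rw [hη.hodgeGroupC_eq_lefschetzIdentityC_iff_finrank_eq hG, ← hX.two_mul_finrank_mul_finrank_lefschetzLie_add_eq_of_isAlbertTypeIII hη hG h]
  have he : 0 < finrank ℚ (centerField Ψ hX) := finrank_pos
  constructor
  · intro h'; rw [h']
  · intro h'; exact Nat.eq_of_mul_eq_mul_left he (Nat.eq_of_mul_eq_mul_left two_pos (Nat.add_right_cancel h'))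

end Albert

end ComplexTorus

end Literature.Geometry.Kaehler
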